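import Mathlib
import HarnessLib
import Summits.NavierStokesRegularity.NavierStokesRegularity.Theorems.PoloidalWindowDoorLrcModEntireCaseISfreeBranch
import Summits.NavierStokesRegularity.NavierStokesRegularity.Theorems.PoloidalWindowDoorLrcModEntireSheetCauchyDataPeriodic
import Summits.NavierStokesRegularity.NavierStokesRegularity.Theorems.PoloidalWindowDoorLrcModEntireSlopeSmooth

/-!
# Route `PoloidalWindowDoor`, item `LrcModEntire` (stmt-NavierStokesRegularity-20428), cell (Q4-sonic, straight, μ < 0) `stub_Q4sonicLineNeg`, case I —
# THE s-FREE END HOLDS: strain row `≡ 0` on the web sheet over an open interval of times ⇒ `False`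

Cell ns-regularity-ideate, stub-worker seat ns-poloidal-K2-p2 g17 under the LEAD of item 20428 (ns-poloidal-K2-p3 g17; T2B-g17 §7/§9); `--supports
stmt-NavierStokesRegularity-20428 --as helper`.  Discharges the FIRST hypothesis of `…CaseISonicTimes.caseI_false_of_ends` (its text verbatim) by port-2 g8's
assembled s-free branch `…CaseISfreeBranch.caseI_sfree_false`, with: the parameter set `O` = the tube box over the time interval (open, non-empty), its
`(t,z)`-shadow `Dμ`, the slope SMOOTH on `Dμ` by port-2's `…SlopeSmooth.slope_contDiffAt_of_horizDeriv_ne_zero` (next to every web point there is a point of the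
same horizontal plane with `∂_{Je}U₂ ≠ 0`: the cross-section `n ↦ σU₂(frameCLM e (0,n,z))` has a STRICT maximum at `n₀`, so by the mean value theorem its derivative
is non-zero somewhere between `n₀` and `(n₀+r)/2`), `μ ≠ 1` by `μ < 0`, and the data `P = Q = 0` on `{m = 0}` by `…SheetCauchyDataPeriodic.cauchyData_sfree_of_strain`.

* `exists_horizDeriv_ne_zero` — the point with a non-zero horizontal derivative of `U₂` on the plane of a web point;
* ★★ `sfreeEnd_holds` — the s-FREE END (box currency, text of `caseI_false_of_ends`'s first hypothesis).

WHAT THIS IS NOT: not a claim about Navier–Stokes regularity; one of the two ends of the v14 child of the research slot `stub_Q4sonicLineNeg`; no registry stub is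
closed here; items 20428 / 19708 / 27893 OPEN (bears_on LADDER-NS N0).
-/

noncomputable section

set_option linter.dupNamespace false
set_option linter.style.longLine false

namespace Summit.NavierStokesRegularity.NavierStokesRegularity.Theorems.PoloidalWindowDoorLrcModEntireCaseISfreeEnd

open Set Function Filter Topology Metric
open scoped RealInnerProductSpace InnerProductSpace ContDiff
open Literature.Analysis
open Summit.NavierStokesRegularity.NavierStokesRegularity.Theorems.LocalSineTubeDoorProfileAlignedWindowRigidityAncient
open Summit.NavierStokesRegularity.NavierStokesRegularity.Theorems.PoloidalWindowDoorPoloidalWindowRigidityWindow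
open Summit.NavierStokesRegularity.NavierStokesRegularity.Theorems.PoloidalWindowDoorLrcModEntireSheetSystemUniqueness
open Summit.NavierStokesRegularity.NavierStokesRegularity.Theorems.PoloidalWindowDoorLrcModEntireSheetFlattenTools
open Summit.NavierStokesRegularity.NavierStokesRegularity.Theorems.PoloidalWindowDoorLrcModEntireShearedCoordinates
open Summit.NavierStokesRegularity.NavierStokesRegularity.Theorems.PoloidalWindowDoorLrcModEntireShearedKinematics
open Summit.NavierStokesRegularity.NavierStokesRegularity.Theorems.PoloidalWindowDoorLrcModEntireQ4SonicHotSheetTimeSplit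
open Summit.NavierStokesRegularity.NavierStokesRegularity.Theorems.PoloidalWindowDoorLrcModEntireCaseISfreeBranch
open Summit.NavierStokesRegularity.NavierStokesRegularity.Theorems.PoloidalWindowDoorLrcModEntireSheetCauchyDataPeriodic
open Summit.NavierStokesRegularity.NavierStokesRegularity.Theorems.PoloidalWindowDoorLrcModEntireSlopeSmooth

variable {C : ℝ} {U : ℝ → E3 → E3} {R μ : ℝ → ℝ → ℝ} {σ r δ' : ℝ} {e : E3} {n₀ : ℝ × ℝ × ℝ → ℝ} {κt : ℝ → ℝ → ℝ}

/-- **Next to every web point there is a point of the same plane and time with a non-zero horizontal derivative of `U₂`.**  From the package block (unique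
STRICT maximiser `n₀ ∈ (−r, r)` of the cross-section `n ↦ σU₂(−1+τ, frameCLM e (s,n,z))` on `[−r, r]`) and smoothness of the slice: by the mean value theorem the
derivative of the cross-section is negative at some `n` between `n₀` and `(n₀ + r)/2`, so `∂₀U₂ ≠ 0` or `∂₁U₂ ≠ 0` there. -/
theorem exists_horizDeriv_ne_zero
    (hrate : FluidPDE.HasTypeITimeDecay C U) (hcont : ContinuousOn (uncurry U) (Iio (0 : ℝ) ×ˢ univ))
    (hmild : ∀ s t : ℝ, s < t → t < 0 → ∀ x, U t x = UnboundedOperators.heatExtension (U s) (t - s) x - FluidPDE.oseenDuhamel 1 s U U t x)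
    (hδ'h : δ' < 1 / 2) (he2 : e 2 = 0)
    (hpack : ∀ q : ℝ × ℝ × ℝ, |q.1| < δ' → |q.2.2| < δ' →
        n₀ q ∈ Ioo (-r) r ∧
        σ * U (-1 + q.1) (frameCLM e (q.2.1, n₀ q, q.2.2)) 2 = R q.1 q.2.2 ∧
        (∀ n ∈ Icc (-r) r, n ≠ n₀ q → σ * U (-1 + q.1) (frameCLM e (q.2.1, n, q.2.2)) 2 < R q.1 q.2.2) ∧
        (∀ w : E3, w 2 = 0 → fderiv ℝ (fun y => U (-1 + q.1) y 2) (frameCLM e (q.2.1, n₀ q, q.2.2)) w = 0) ∧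
        (∀ m : ℕ∞, ContDiffAt ℝ m n₀ q) ∧
        0 < κt q.1 q.2.2 ∧
        fderiv ℝ (fderiv ℝ (fun y => σ * U (-1 + q.1) y 2)) (frameCLM e (q.2.1, n₀ q, q.2.2)) e e +
            fderiv ℝ (fderiv ℝ (fun y => σ * U (-1 + q.1) y 2)) (frameCLM e (q.2.1, n₀ q, q.2.2)) (Jvec e) (Jvec e) =
          -κt q.1 q.2.2 ∧
        κt q.1 q.2.2 * (fderiv ℝ n₀ q ((0 : ℝ), (0 : ℝ), (1 : ℝ))) ^ 2 =
          (deriv (deriv (R q.1)) q.2.2 - μ (-1 + q.1) q.2.2 * κt q.1 q.2.2) * (1 + (fderiv ℝ n₀ q ((0 : ℝ), (1 : ℝ), (0 : ℝ))) ^ 2))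
    {τ z : ℝ} (hτ : |τ| < δ') (hz : |z| < δ') :
    ∃ (x₀ : E3) (b : Fin 3), x₀ 2 = z ∧ b ≠ 2 ∧ fderiv ℝ (U (-1 + τ)) x₀ (EuclideanSpace.single b 1) 2 ≠ 0 := by
  set t : ℝ := -1 + τ with ht_def
  have ht : t < 0 := by rw [ht_def]; linarith [(abs_lt.1 (lt_trans hτ hδ'h)).2]
  obtain ⟨hn₀, hval, hstrict, -, -, -, -, -⟩ := hpack (τ, (0 : ℝ), z) hτ hz
  simp only at hn₀ hval hstrict
  set nw : ℝ := n₀ (τ, (0 : ℝ), z) with hnw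
  -- the cross-section and its derivative
  set θ : E3 → ℝ := fun y => U t y 2 with hθ_def
  have hUan : AnalyticOnNhd ℝ (U t) univ := analyticOnNhd_slice hcont (bdd_of_hasTypeITimeDecay hrate) hmild ht
  have hUd : Differentiable ℝ (U t) := (hUan.contDiff (n := ∞)).differentiable (by simp)
  have hθd : Differentiable ℝ θ := fun x => (EuclideanSpace.proj (𝕜 := ℝ) (2 : Fin 3)).differentiableAt.comp x (hUd x)
  set f : ℝ → ℝ := fun n => σ * θ (frameCLM e ((0 : ℝ), n, z)) with hf_def
  have hline : ∀ n : ℝ, HasDerivAt (fun a : ℝ => frameCLM e ((0 : ℝ), a, z)) (frameCLM e ((0 : ℝ), (1 : ℝ), (0 : ℝ))) n := fun n =>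
    (frameCLM e).hasFDerivAt.comp_hasDerivAt n (hasDerivAt_sLine 0 z n)
  have hJe : frameCLM e ((0 : ℝ), (1 : ℝ), (0 : ℝ)) = Jvec e := by rw [frameCLM_apply]; simp
  have hfd : ∀ n : ℝ, HasDerivAt f (σ * fderiv ℝ θ (frameCLM e ((0 : ℝ), n, z)) (Jvec e)) n := by
    intro n
    have h := ((hθd _).hasFDerivAt.comp_hasDerivAt n (hline n)).const_mul σ
    rw [hJe] at h
    exact h
  -- mean value theorem between `n₀` and `(n₀ + r)/2`
  set n₁ : ℝ := (nw + r) / 2 with hn₁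
  have hlt : nw < n₁ := by rw [hn₁]; linarith [hn₀.2]
  have hn₁I : n₁ ∈ Icc (-r) r := ⟨by rw [hn₁]; linarith [hn₀.1, hn₀.2], by rw [hn₁]; linarith [hn₀.2]⟩
  have hfc : ContinuousOn f (Icc nw n₁) := fun n _ => (hfd n).continuousAt.continuousWithinAt
  obtain ⟨c, hc, hcslope⟩ := exists_hasDerivAt_eq_slope f (fun n => σ * fderiv ℝ θ (frameCLM e ((0 : ℝ), n, z)) (Jvec e)) hlt hfc
    (fun n _ => hfd n)
  have hfn₁ : f n₁ < f nw := by
    have h := hstrict n₁ hn₁I hlt.ne'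
    show σ * U t (frameCLM e ((0 : ℝ), n₁, z)) 2 < σ * U t (frameCLM e ((0 : ℝ), nw, z)) 2
    rw [ht_def]; linarith [h, hval]
  have hneg : σ * fderiv ℝ θ (frameCLM e ((0 : ℝ), c, z)) (Jvec e) < 0 := by
    rw [hcslope]
    exact div_neg_of_neg_of_pos (by linarith) (by linarith)
  have hne : fderiv ℝ θ (frameCLM e ((0 : ℝ), c, z)) (Jvec e) ≠ 0 := by
    intro h0; rw [h0, mul_zero] at hneg; exact lt_irrefl _ hneg
  -- in coordinates: `Je = −e₁·E0 + e₀·E1`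
  set x₀ : E3 := frameCLM e ((0 : ℝ), c, z) with hx₀
  have hx₀2 : x₀ 2 = z := by rw [hx₀, frameCLM_apply_two he2]
  have hcoord : ∀ w : E3, fderiv ℝ (U t) x₀ w 2 = fderiv ℝ θ x₀ w := by
    intro w
    have h := ((EuclideanSpace.proj (𝕜 := ℝ) (2 : Fin 3)).hasFDerivAt.comp x₀ (hUd x₀).hasFDerivAt).fderiv
    have e3 : (⇑(EuclideanSpace.proj (𝕜 := ℝ) (2 : Fin 3)) ∘ U t) = θ := by funext y; simp [hθ_def]
    rw [e3] at h
    rw [h]; rfl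
  have hsplit : fderiv ℝ θ x₀ (Jvec e) = -(e 1) * fderiv ℝ θ x₀ (EuclideanSpace.single 0 (1 : ℝ)) + e 0 * fderiv ℝ θ x₀ (EuclideanSpace.single 1 (1 : ℝ)) := by
    rw [Jvec_decomp e, map_add, map_smul, map_smul, smul_eq_mul, smul_eq_mul]
  by_cases h0 : fderiv ℝ θ x₀ (EuclideanSpace.single 0 (1 : ℝ)) = 0
  · have h1 : fderiv ℝ θ x₀ (EuclideanSpace.single 1 (1 : ℝ)) ≠ 0 := by
      intro h1
      apply hne
      rw [hsplit, h0, h1, mul_zero, mul_zero, add_zero]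
    refine ⟨x₀, 1, hx₀2, by decide, ?_⟩
    rw [hcoord]; exact h1
  · refine ⟨x₀, 0, hx₀2, by decide, ?_⟩
    rw [hcoord]; exact h0

/-- ★★ **THE s-FREE END HOLDS** (first hypothesis of `…CaseISonicTimes.caseI_false_of_ends`, verbatim): in the box currency, if on an open interval of times
`(τ₁, τ₂) ⊂ [−δ′, δ′]` the web-frame strain row vanishes at every web point, then `False` — by port-2 g8's `…CaseISfreeBranch.caseI_sfree_false` with `O` the tube box
over `(τ₁, τ₂)`, the slope smooth on its `(t,z)`-shadow (`…SlopeSmooth` + `exists_horizDeriv_ne_zero`), `μ ≠ 1` (`μ < 0`), data `P = Q = 0` by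
`…SheetCauchyDataPeriodic.cauchyData_sfree_of_strain`. -/
theorem sfreeEnd_holds : ∀ (C σ ρ δ' r : ℝ) (U : ℝ → EuclideanSpace ℝ (Fin 3) → EuclideanSpace ℝ (Fin 3)) (R μ : ℝ → ℝ → ℝ) (e : EuclideanSpace ℝ (Fin 3))
      (n₀ : ℝ × ℝ × ℝ → ℝ) (κt : ℝ → ℝ → ℝ) (τ₁ τ₂ : ℝ),
      Literature.Analysis.FluidPDE.HasTypeITimeDecay C U →
      ContinuousOn (Function.uncurry U) (Set.Iio (0 : ℝ) ×ˢ Set.univ) →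
      (∀ s t : ℝ, s < t → t < 0 → ∀ x, U t x =
        Literature.Analysis.UnboundedOperators.heatExtension (U s) (t - s) x - Literature.Analysis.FluidPDE.oseenDuhamel 1 s U U t x) →
      (∀ t < 0, Literature.Analysis.FluidPDE.VectorCalculus.IsDivFree (U t)) →
      (∀ s < 0, ∀ y, ⟪Literature.Analysis.FluidPDE.curl (U s) y, EuclideanSpace.single 2 1⟫_ℝ = 0) →
      U (-1) 0 2 ≠ 0 → (σ = 1 ∨ σ = -1) → ContDiff ℝ 3 (Function.uncurry μ) →
      (∀ t : ℝ, |t + 1| < ρ → ∀ x : EuclideanSpace ℝ (Fin 3), |x 2| < ρ → ∀ b : Fin 3, b ≠ 2 →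
        fderiv ℝ (U t) x (EuclideanSpace.single 2 1) b = μ t (x 2) * fderiv ℝ (U t) x (EuclideanSpace.single b 1) 2) →
      δ' ≤ ρ → δ' < 1 / 2 → e 2 = 0 → e 0 ^ 2 + e 1 ^ 2 = 1 →
      (∀ q : ℝ × ℝ × ℝ, |q.1| < δ' → |q.2.2| < δ' →
        n₀ q ∈ Set.Ioo (-r) r ∧
        σ * U (-1 + q.1) (frameCLM e (q.2.1, n₀ q, q.2.2)) 2 = R q.1 q.2.2 ∧
        (∀ n ∈ Set.Icc (-r) r, n ≠ n₀ q → σ * U (-1 + q.1) (frameCLM e (q.2.1, n, q.2.2)) 2 < R q.1 q.2.2) ∧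
        (∀ w : EuclideanSpace ℝ (Fin 3), w 2 = 0 → fderiv ℝ (fun y => U (-1 + q.1) y 2) (frameCLM e (q.2.1, n₀ q, q.2.2)) w = 0) ∧
        (∀ m : ℕ∞, ContDiffAt ℝ m n₀ q) ∧
        0 < κt q.1 q.2.2 ∧
        fderiv ℝ (fderiv ℝ (fun y => σ * U (-1 + q.1) y 2)) (frameCLM e (q.2.1, n₀ q, q.2.2)) e e +
            fderiv ℝ (fderiv ℝ (fun y => σ * U (-1 + q.1) y 2)) (frameCLM e (q.2.1, n₀ q, q.2.2)) (Jvec e) (Jvec e) =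
          -κt q.1 q.2.2 ∧
        κt q.1 q.2.2 * (fderiv ℝ n₀ q ((0 : ℝ), (0 : ℝ), (1 : ℝ))) ^ 2 =
          (deriv (deriv (R q.1)) q.2.2 - μ (-1 + q.1) q.2.2 * κt q.1 q.2.2) * (1 + (fderiv ℝ n₀ q ((0 : ℝ), (1 : ℝ), (0 : ℝ))) ^ 2)) →
      (∀ τ : ℝ, |τ| < δ' → ∃ A B : ℝ, ∀ z : ℝ, |z| < δ' → R τ z = A + B * z) →
      (∀ τ s z : ℝ, |τ| < δ' → |z| < δ' → n₀ (τ, s, z) = n₀ (τ, (0 : ℝ), z)) →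
      (∀ τ z : ℝ, |τ| < δ' → |z| < δ' → μ (-1 + τ) z < 0) →
      -δ' ≤ τ₁ → τ₁ < τ₂ → τ₂ ≤ δ' →
      (∀ τ ∈ Set.Ioo τ₁ τ₂, ∀ s z : ℝ, |z| < δ' →
        ⟪fderiv ℝ (U (-1 + τ)) (frameCLM e (s, n₀ (τ, s, z), z)) e, e⟫_ℝ = 0 ∧
        ⟪fderiv ℝ (U (-1 + τ)) (frameCLM e (s, n₀ (τ, s, z), z)) e, Jvec e⟫_ℝ = 0) → False := by
  intro C σ ρ δ' r U R μ e n₀ κt τ₁ τ₂ hrate hcont hmild hdiv hpol hUne hσ hμ3 hslabU hδ'ρ hδ'h he2 hunit hpack hsonI hparI hμnegB hτ₁ hτ₁₂ hτ₂ hfree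
  have hJabs : ∀ τ ∈ Ioo τ₁ τ₂, |τ| < δ' := fun τ hτ => abs_lt.2 ⟨by linarith [hτ.1], by linarith [hτ.2]⟩
  set d : ℝ × ℝ → ℝ := fun q => n₀ (q.1 + 1, (0 : ℝ), q.2) with hd_def
  -- the parameter set and its shadow
  set O : Set Y3 := {y | y.1 + 1 ∈ Ioo τ₁ τ₂ ∧ |y.2.2| < δ'} with hO_def
  set Dμ : Set (ℝ × ℝ) := {p | p.1 + 1 ∈ Ioo τ₁ τ₂ ∧ |p.2| < δ'} with hDμ_def
  have hO : IsOpen O := by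
    have h1 : IsOpen {y : Y3 | y.1 + 1 ∈ Ioo τ₁ τ₂} := isOpen_Ioo.preimage (continuous_fst.add continuous_const)
    have h2 : IsOpen {y : Y3 | |y.2.2| < δ'} := isOpen_lt (continuous_abs.comp (continuous_snd.comp continuous_snd)) continuous_const
    exact h1.inter h2
  have hDμ : IsOpen Dμ := by
    have h1 : IsOpen {p : ℝ × ℝ | p.1 + 1 ∈ Ioo τ₁ τ₂} := isOpen_Ioo.preimage (continuous_fst.add continuous_const)
    have h2 : IsOpen {p : ℝ × ℝ | |p.2| < δ'} := isOpen_lt (continuous_abs.comp continuous_snd) continuous_const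
    exact h1.inter h2
  have hδ' : 0 < δ' := by linarith
  have hOne : O.Nonempty := ⟨((τ₁ + τ₂) / 2 - 1, (0 : ℝ), (0 : ℝ)), ⟨by constructor <;> linarith, by simpa using hδ'⟩⟩
  have hObox : ∀ y ∈ O, |y.1 + 1| < δ' ∧ |y.2.2| < δ' := fun y hy => ⟨hJabs _ hy.1, hy.2⟩
  have hOμ : ∀ y ∈ O, (y.1, y.2.2) ∈ Dμ := fun y hy => hy
  have hμ1 : ∀ y ∈ O, μ y.1 y.2.2 ≠ 1 := by
    intro y hy
    have h := hμnegB (y.1 + 1) y.2.2 (hJabs _ hy.1) hy.2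
    rw [show -1 + (y.1 + 1) = y.1 by ring] at h
    linarith
  -- smoothness of the slope on `Dμ`
  have hA := isTypeIAncientMild_of_class hrate hcont hmild hdiv
  set T : Set ℝ := {t | |t + 1| < ρ} ∩ Iio 0 with hT_def
  have hT : IsOpen T := (isOpen_lt (continuous_abs.comp (continuous_id.add continuous_const)) continuous_const).inter isOpen_Iio
  have hUT : ContDiffOn ℝ ∞ (uncurry U) (T ×ˢ (univ : Set E3)) := hA.contDiffOn.mono (prod_mono (fun t ht => ht.2) Subset.rfl)
  have hslabT : ∀ t ∈ T, ∀ x : E3, |x 2| < ρ → ∀ b : Fin 3, b ≠ 2 →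
      fderiv ℝ (U t) x (EuclideanSpace.single 2 1) b = μ t (x 2) * fderiv ℝ (U t) x (EuclideanSpace.single b 1) 2 := fun t ht => hslabU t ht.1
  have hμs : ContDiffOn ℝ ∞ (uncurry μ) Dμ := by
    intro p hp
    have hτ : |p.1 + 1| < δ' := hJabs _ hp.1
    obtain ⟨x₀, b, hx₀2, hb, hgrad⟩ := exists_horizDeriv_ne_zero (U := U) (κt := κt) hrate hcont hmild hδ'h he2 hpack hτ hp.2
    have ht0T : -1 + (p.1 + 1) ∈ T := by
      refine ⟨?_, ?_⟩
      · show |-1 + (p.1 + 1) + 1| < ρ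
        rw [show -1 + (p.1 + 1) + 1 = p.1 + 1 by ring]; exact lt_of_lt_of_le hτ hδ'ρ
      · show -1 + (p.1 + 1) < 0
        linarith [(abs_lt.1 (lt_trans hτ hδ'h)).2]
    have hx₀ρ : |x₀ 2| < ρ := by rw [hx₀2]; exact lt_of_lt_of_le hp.2 hδ'ρ
    have h := slope_contDiffAt_of_horizDeriv_ne_zero hT hUT hslabT ht0T hx₀ρ hb hgrad
    rw [hx₀2, show -1 + (p.1 + 1) = p.1 by ring] at h
    exact h.contDiffWithinAt
  -- the data `P = Q = 0`
  have hP0 : ∀ y ∈ O, (PST (uncurry U) e ∘ shearMap e d) (y, 0) = 0 := fun y hy =>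
    (cauchyData_sfree_of_strain (C := C) hrate hcont hmild hdiv hδ'h hparI hJabs hfree hy.1 hy.2).1
  have hQ0 : ∀ y ∈ O, (QST (uncurry U) e ∘ shearMap e d) (y, 0) = 0 := fun y hy =>
    (cauchyData_sfree_of_strain (C := C) hrate hcont hmild hdiv hδ'h hparI hJabs hfree hy.1 hy.2).2
  exact caseI_sfree_false hrate hcont hmild hdiv hpol hUne hσ hμ3 hslabU hδ'ρ hδ'h he2 hunit hpack hsonI hparI hO hOne hObox hDμ hμs hOμ hμ1 hP0 hQ0

end Summit.NavierStokesRegularity.NavierStokesRegularity.Theorems.PoloidalWindowDoorLrcModEntireCaseISfreeEnd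

end
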